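import Summits.KontsevichZagierPeriods.Zeta5Search.SymRayBasics
import Summits.KontsevichZagierPeriods.Zeta5Search.WedgeDictionaryInstances
import HarnessLib

/-!
# The symmetric ray at `n = 0, 1, 2`: exact canonical coefficients (cell `pub-zeta5`, P1)

HONEST FRAMING: systematic search; no irrationality claim unless certified.

OUR work (Summit side), P1 seat generation 3. Initial values for the third-order recursions of the symmetric-ray programme:
the canonical coefficients `U, W, V` (`WedgeDictionary.coeffU/W/V`) of `b_n = (3n;n⁷)` and of the partner `b'_n = (3n;n+1,n⁶)`
at `n = 0, 1, 2`, from explicit partial-fraction tables (kernel arithmetic; `n = 1` reuses the typer's tables `cSym`, `cSym1` of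
`WedgeDictionaryInstances`):

| `n` | `U(b_n)` | `W(b_n)` | `V(b_n)` | `U(b'_n)` | `W(b'_n)` | `V(b'_n)` |
|---|---|---|---|---|---|---|
| 0 | 2 | 0 | 0 | 0 | 2 | 0 |
| 1 | 18 | 66 | 98 | −4 | −24 | −33 |
| 2 | 469/8 | 6125/32 | 74463/256 | −69 | −441/2 | −43085/128 |

(`= (2/n!⁴)·(u_n, w_n, v_n)` and `−(2/n!⁴)·(ũ_n, w̃_n, ṽ_n)` of Zudilin 2002, §2: `r₁ = 9ζ(5)+33ζ(3)−49`, `r̃₁ = 2ζ(5)+12ζ(3)−33/2`,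
`r₂ = 469ζ(5)+(6125/4)ζ(3)−74463/32`, `r̃₂ = 552ζ(5)+1764ζ(3)−43085/16`.)
-/

noncomputable section

open Finset Polynomial

namespace Summit.KontsevichZagierPeriods.Zeta5Search.SymRay

open Summit.KontsevichZagierPeriods.Zeta5Search.DualSeries
open Summit.KontsevichZagierPeriods.Zeta5Search.WedgeDictionary
open Literature.NumberTheory.Transcendental
open Literature.NumberTheory.Transcendental.BallRivoal (pfEval harm)

/-! ### `n = 1`: the typer's tables -/

/-- `bRay 1 = (3;1⁷) = bSym` of `WedgeDictionaryInstances`. -/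
theorem bRay_one_eq : bRay 1 = bSym := by
  funext j; simp [bRay, bSym]

/-- `bRay' 1 = (3;2,1⁶) = bSym1`. -/
theorem bRay'_one_eq : bRay' 1 = bSym1 := by
  rw [bRay', bRay_one_eq]; exact update_bSym

/-- `U(b_1) = 18`, `W(b_1) = 66`, `V(b_1) = 98`. -/
theorem values_one : coeffU (bRay 1) = 18 ∧ coeffW (bRay 1) = 66 ∧ coeffV (bRay 1) = 98 := by
  rw [bRay_one_eq]
  refine ⟨coeff_bSym.1, coeff_bSym.2, ?_⟩
  have hB : (bSym 0).toNat = 3 := by decide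
  rw [coeffV_eq isPFData_bSym, hB]
  simp only [sum_range_succ, sum_range_zero, cSym, harm]
  norm_num

/-- `U(b'_1) = −4`, `W(b'_1) = −24`, `V(b'_1) = −33`. -/
theorem values_one' : coeffU (bRay' 1) = -4 ∧ coeffW (bRay' 1) = -24 ∧ coeffV (bRay' 1) = -33 := by
  rw [bRay'_one_eq]
  refine ⟨coeff_bSym1.1, coeff_bSym1.2, ?_⟩
  have hB : (bSym1 0).toNat = 3 := by decide
  rw [coeffV_eq isPFData_bSym1, hB]
  simp only [sum_range_succ, sum_range_zero, cSym1, harm]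
  norm_num

/-! ### `n = 0` -/

/-- Data of `R_0 = 2/(t+1)⁵`. -/
def cRay0 : ℕ → ℕ → ℚ := fun o p => if o = 4 ∧ p = 0 then 2 else 0

/-- Data of `R'_0 = 2/(t+1)³`. -/
def cRay0' : ℕ → ℕ → ℚ := fun o p => if o = 2 ∧ p = 0 then 2 else 0

/-- `cRay0` is the data of `bRay 0`. -/
theorem isPFData_zero : IsPFData (bRay 0) cRay0 := by
  intro t ht
  have hB : (bRay 0 0).toNat = 0 := by decide
  rw [hB] at ht ⊢
  have h1 : t + 1 ≠ 0 := by have := ht 0 le_rfl; simpa using this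
  rw [show (0 : ℕ) = 3 * 0 from rfl, eval_numPoly_bRay 0 t]
  simp only [pfEval, sum_range_succ, sum_range_zero, cRay0, BallRivoal.poch, prod_range_succ, prod_range_zero]
  norm_num
  field_simp

/-- `cRay0'` is the data of `bRay' 0`. -/
theorem isPFData_zero' : IsPFData (bRay' 0) cRay0' := by
  intro t ht
  have hB : (bRay' 0 0).toNat = 0 := by decide
  rw [hB] at ht ⊢
  have h1 : t + 1 ≠ 0 := by have := ht 0 le_rfl; simpa using this
  rw [show (0 : ℕ) = 3 * 0 from rfl, eval_numPoly_bRay' 0 t]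
  simp only [pfEval, sum_range_succ, sum_range_zero, cRay0', BallRivoal.poch, prod_range_succ, prod_range_zero]
  norm_num
  field_simp

/-- `U(b_0) = 2`, `W(b_0) = 0`, `V(b_0) = 0`. -/
theorem values_zero : coeffU (bRay 0) = 2 ∧ coeffW (bRay 0) = 0 ∧ coeffV (bRay 0) = 0 := by
  have hB : (bRay 0 0).toNat = 0 := by decide
  rw [coeffU_eq isPFData_zero, coeffW_eq isPFData_zero, coeffV_eq isPFData_zero, hB]
  simp only [sum_range_succ, sum_range_zero, cRay0, harm]
  norm_num

/-- `U(b'_0) = 0`, `W(b'_0) = 2`, `V(b'_0) = 0`. -/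
theorem values_zero' : coeffU (bRay' 0) = 0 ∧ coeffW (bRay' 0) = 2 ∧ coeffV (bRay' 0) = 0 := by
  have hB : (bRay' 0 0).toNat = 0 := by decide
  rw [coeffU_eq isPFData_zero', coeffW_eq isPFData_zero', coeffV_eq isPFData_zero', hB]
  simp only [sum_range_succ, sum_range_zero, cRay0', harm]
  norm_num

/-! ### `n = 2` -/

/-- Data of `R_2 = (2t+8)(t+1)(t+2)(t+6)(t+7)/((t+3)(t+4)(t+5))⁶` (poles `p = 2, 3, 4`). -/
def cRay2 : ℕ → ℕ → ℚ := fun o p =>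
  if o = 0 ∧ p = 2 then -679 else if o = 0 ∧ p = 3 then 1358 else if o = 0 ∧ p = 4 then -679 else
  if o = 1 ∧ p = 2 then 37331 / 128 else if o = 1 ∧ p = 4 then -37331 / 128 else
  if o = 2 ∧ p = 2 then -6867 / 64 else if o = 2 ∧ p = 3 then 406 else if o = 2 ∧ p = 4 then -6867 / 64 else
  if o = 3 ∧ p = 2 then 1015 / 32 else if o = 3 ∧ p = 4 then -1015 / 32 else
  if o = 4 ∧ p = 2 then -107 / 16 else if o = 4 ∧ p = 3 then 72 else if o = 4 ∧ p = 4 then -107 / 16 else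
  if o = 5 ∧ p = 2 then 3 / 4 else if o = 5 ∧ p = 4 then -3 / 4 else 0

/-- Data of `R'_2 = (2t+8)(t+1)(t+2)(t+6)(t+7)/((t+3)⁵(t+4)⁶(t+5)⁵)`. -/
def cRay2' : ℕ → ℕ → ℚ := fun o p =>
  if o = 0 ∧ p = 2 then 476 else if o = 0 ∧ p = 3 then -952 else if o = 0 ∧ p = 4 then 476 else
  if o = 1 ∧ p = 2 then -1463 / 8 else if o = 1 ∧ p = 4 then 1463 / 8 else
  if o = 2 ∧ p = 2 then 227 / 4 else if o = 2 ∧ p = 3 then -334 else if o = 2 ∧ p = 4 then 227 / 4 else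
  if o = 3 ∧ p = 2 then -101 / 8 else if o = 3 ∧ p = 4 then 101 / 8 else
  if o = 4 ∧ p = 2 then 3 / 2 else if o = 4 ∧ p = 3 then -72 else if o = 4 ∧ p = 4 then 3 / 2 else 0

/-- `(x)_2 = x(x+1)` and `(x)_7`, explicitly. -/
private theorem poch_two_seven (x : ℚ) : BallRivoal.poch x 2 = x * (x + 1) ∧
    BallRivoal.poch x 7 = x * (x + 1) * (x + 2) * (x + 3) * (x + 4) * (x + 5) * (x + 6) := by
  constructor <;> simp [BallRivoal.poch, prod_range_succ]

/-- The pole conditions at `n = 2`. -/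
private theorem poles_two {t : ℚ} (ht : ∀ p : ℕ, p ≤ 6 → t + (p : ℚ) + 1 ≠ 0) :
    t + 1 ≠ 0 ∧ t + 2 ≠ 0 ∧ t + 3 ≠ 0 ∧ t + 4 ≠ 0 ∧ t + 5 ≠ 0 ∧ t + 6 ≠ 0 ∧ t + 7 ≠ 0 := by
  refine ⟨?_, ?_, ?_, ?_, ?_, ?_, ?_⟩
  · have := ht 0 (by norm_num); intro h; apply this; push_cast; linarith
  · have := ht 1 (by norm_num); intro h; apply this; push_cast; linarith
  · have := ht 2 (by norm_num); intro h; apply this; push_cast; linarith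
  · have := ht 3 (by norm_num); intro h; apply this; push_cast; linarith
  · have := ht 4 (by norm_num); intro h; apply this; push_cast; linarith
  · have := ht 5 (by norm_num); intro h; apply this; push_cast; linarith
  · have := ht 6 (by norm_num); intro h; apply this; push_cast; linarith

/-- `cRay2` is the data of `bRay 2`. -/
theorem isPFData_two : IsPFData (bRay 2) cRay2 := by
  intro t ht
  have hB : (bRay 2 0).toNat = 6 := by decide
  rw [hB] at ht ⊢
  obtain ⟨h1, h2, h3, h4, h5, h6, h7⟩ := poles_two ht
  rw [eval_numPoly_bRay 2 t, show (6 : ℕ) + 1 = 7 from rfl, (poch_two_seven (t + 1)).2, (poch_two_seven (t + 1)).1,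
    show t + 2 * ((2 : ℕ) : ℚ) + 2 = t + 6 by push_cast; ring, (poch_two_seven (t + 6)).1,
    show 2 * t + 3 * ((2 : ℕ) : ℚ) + 2 = 2 * t + 8 by push_cast; ring]
  simp (config := {decide := true}) only [pfEval, sum_range_succ, sum_range_zero, cRay2, if_true, if_false,
    Nat.cast_ofNat, Nat.cast_zero, Nat.cast_one, zero_div, add_zero, zero_add]
  simp only [Nat.reduceAdd, pow_one, show t + 1 + 1 = t + 2 by ring, show t + 1 + 2 = t + 3 by ring,
    show t + 1 + 3 = t + 4 by ring, show t + 1 + 4 = t + 5 by ring, show t + 1 + 5 = t + 6 by ring,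
    show t + 1 + 6 = t + 7 by ring, show t + 6 + 1 = t + 7 by ring, show t + 2 + 1 = t + 3 by ring,
    show t + 3 + 1 = t + 4 by ring, show t + 4 + 1 = t + 5 by ring]
  field_simp
  ring

/-- `cRay2'` is the data of `bRay' 2`. -/
theorem isPFData_two' : IsPFData (bRay' 2) cRay2' := by
  intro t ht
  have hB : (bRay' 2 0).toNat = 6 := by decide
  rw [hB] at ht ⊢
  obtain ⟨h1, h2, h3, h4, h5, h6, h7⟩ := poles_two ht
  rw [eval_numPoly_bRay' 2 t, show (6 : ℕ) + 1 = 7 from rfl, (poch_two_seven (t + 1)).2, (poch_two_seven (t + 1)).1,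
    show t + 2 * ((2 : ℕ) : ℚ) + 2 = t + 6 by push_cast; ring, (poch_two_seven (t + 6)).1,
    show 2 * t + 3 * ((2 : ℕ) : ℚ) + 2 = 2 * t + 8 by push_cast; ring]
  simp (config := {decide := true}) only [pfEval, sum_range_succ, sum_range_zero, cRay2', if_true, if_false,
    Nat.cast_ofNat, Nat.cast_zero, Nat.cast_one, zero_div, add_zero, zero_add]
  simp only [Nat.reduceAdd, pow_one, show t + 1 + 1 = t + 2 by ring, show t + 1 + 2 = t + 3 by ring,
    show t + 1 + 3 = t + 4 by ring, show t + 1 + 4 = t + 5 by ring, show t + 1 + 5 = t + 6 by ring,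
    show t + 1 + 6 = t + 7 by ring, show t + 6 + 1 = t + 7 by ring, show t + 2 + 1 = t + 3 by ring,
    show t + 3 + 1 = t + 4 by ring, show t + 4 + 1 = t + 5 by ring]
  field_simp
  ring

/-- `U(b_2) = 469/8`, `W(b_2) = 6125/32`, `V(b_2) = 74463/256`. -/
theorem values_two : coeffU (bRay 2) = 469 / 8 ∧ coeffW (bRay 2) = 6125 / 32 ∧ coeffV (bRay 2) = 74463 / 256 := by
  have hB : (bRay 2 0).toNat = 6 := by decide
  rw [coeffU_eq isPFData_two, coeffW_eq isPFData_two, coeffV_eq isPFData_two, hB]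
  simp only [sum_range_succ, sum_range_zero, cRay2, harm]
  norm_num

/-- `U(b'_2) = −69`, `W(b'_2) = −441/2`, `V(b'_2) = −43085/128`. -/
theorem values_two' :
    coeffU (bRay' 2) = -69 ∧ coeffW (bRay' 2) = -441 / 2 ∧ coeffV (bRay' 2) = -43085 / 128 := by
  have hB : (bRay' 2 0).toNat = 6 := by decide
  rw [coeffU_eq isPFData_two', coeffW_eq isPFData_two', coeffV_eq isPFData_two', hB]
  simp only [sum_range_succ, sum_range_zero, cRay2', harm]
  norm_num

end Summit.KontsevichZagierPeriods.Zeta5Search.SymRay
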